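import Literature.Geometry.Riemannian.ParabolicReGraphRegularity
import Literature.Analysis.PDE.ParabolicChainRule
import Mathlib.Analysis.Calculus.FDeriv.Mul
import HarnessLib

/-!
# Jets of a slice-wise inverse

Topic `Literature/Geometry/Riemannian`; continuation of `ParabolicReGraphRegularity.lean`.  Let
`χ` be the slice-wise inverse of `Ψ (x, t) = (φ (x, t), t)` on open regions `U`, `V` of spacetime
(`χ (φ X, t) = x` on `U`; `(χ Ξ, t) ∈ U` and `φ (χ Ξ, t) = ξ` on `V`), with `φ ∈ C²` jointly and
`D_x φ` invertible on `U` (inverses `A X⁻¹`).  Then, at `Ξ ∈ V` and with `P = (χ Ξ, t)`,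

* `D χ (Ξ) = (D_x φ (P))⁻¹`                                   (`spaceDeriv_sliceInverse`),
* `∂ₜ χ (Ξ) = -(D_x φ (P))⁻¹ (∂ₜ φ (P))`                        (`timeDeriv_sliceInverse`),
* `D² χ (Ξ) v w = -(D_x φ (P))⁻¹ (D_x² φ (P) (Dχ v) (Dχ w))`
  (`spaceDeriv_spaceDeriv_sliceInverse`),

`χ` satisfies the guard (`isC21On_sliceInverse`), and sup bounds / parabolic Hölder moduli of the
jets of `χ` follow from those of `φ` (`norm_*_sliceInverse_*`).  With `ParabolicChainRule.lean`
this controls the `C^{2,α}` norm of a re-graphed function (White 2005, p. 1499).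

Everything is PROVED; no definitions, no named facts.

## References

* B. White, *A local regularity theorem for mean curvature flow*, Ann. of Math. 161 (2005), §2.5,
  §8. [White2005]
-/

noncomputable section

open scoped Topology NNReal
open Filter

namespace Literature.Geometry.Riemannian

open Literature.Analysis.PDE Literature.Analysis.PDE.Parabolic Metric Set

namespace ParabolicFlow

variable {E : Type*} [NormedAddCommGroup E] [NormedSpace ℝ E] [CompleteSpace E]

omit [NormedSpace ℝ E] [CompleteSpace E] in
/-- The set of spacetime points as a subset of `E × ℝ` is open when it is open for the parabolic
metric. [folklore] -/
theorem isOpen_setOf_mk_mem {U : Set (Parabolic E)} (hU : IsOpen U) :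
    IsOpen {p : E × ℝ | (⟨p.1, p.2⟩ : Parabolic E) ∈ U} :=
  hU.preimage homeomorphProd.symm.continuous

section Setting

variable {φ χ : Parabolic E → E} {U V : Set (Parabolic E)} (hU : IsOpen U)
  (hφ : ContDiffOn ℝ 2 (fun p : E × ℝ => φ ⟨p.1, p.2⟩) {p | (⟨p.1, p.2⟩ : Parabolic E) ∈ U})
  (hleft : ∀ X ∈ U, χ ⟨φ X, X.t⟩ = X.x)
  (hright : ∀ Ξ ∈ V, (⟨χ Ξ, Ξ.t⟩ : Parabolic E) ∈ U ∧ φ ⟨χ Ξ, Ξ.t⟩ = Ξ.x)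
  (A : Parabolic E → (E ≃L[ℝ] E)) (hA : ∀ X ∈ U, (A X : E →L[ℝ] E) = spaceDeriv φ X)

omit [CompleteSpace E] in
include hU hφ in
/-- The guard for `φ`. [folklore] -/
theorem isC21On_of_setting : IsC21On φ U := by
  have h := isC21On_of_contDiffOn (isOpen_setOf_mk_mem hU) le_rfl hφ
  exact h.mono fun X hX => by simpa using hX

omit [CompleteSpace E] in
include hU hφ hA in
/-- `A X = D_x φ (X) = (fderiv φ̃ (x, t)) ∘ inl` on `U`. [folklore] -/
theorem coe_A_eq_fderiv_comp_inl {X : Parabolic E} (hX : X ∈ U) :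
    (A X : E →L[ℝ] E) =
      (fderiv ℝ (fun p : E × ℝ => φ ⟨p.1, p.2⟩) (X.x, X.t)).comp
        (ContinuousLinearMap.inl ℝ E ℝ) := by
  rw [hA X hX]
  have hd : DifferentiableAt ℝ (fun p : E × ℝ => φ ⟨p.1, p.2⟩) (X.x, X.t) :=
    (hφ.contDiffAt ((isOpen_setOf_mk_mem hU).mem_nhds (by simpa using hX))).differentiableAt
      (by norm_num)
  exact spaceDeriv_eq_fderiv_comp_inl hd

include hU hφ hleft hright hA in
/-- **Strict derivative of the slice-wise inverse**: at `Ξ ∈ V` the map `(ξ, t) ↦ (χ (ξ, t), t)`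
has strict derivative `Ψ'⁻¹`, where `Ψ' (h, τ) = (Dφ̃ (P) (h, τ), τ)`, `P = (χ Ξ, t)`. [folklore] -/
theorem hasStrictFDerivAt_sliceInverse {Ξ : Parabolic E} (hΞ : Ξ ∈ V) :
    ∃ Ψ' : (E × ℝ) ≃L[ℝ] (E × ℝ),
      (Ψ' : E × ℝ →L[ℝ] E × ℝ) =
        (fderiv ℝ (fun p : E × ℝ => φ ⟨p.1, p.2⟩) (χ Ξ, Ξ.t)).prod
          (ContinuousLinearMap.snd ℝ E ℝ) ∧
      HasStrictFDerivAt (fun q : E × ℝ => ((χ ⟨q.1, q.2⟩, q.2) : E × ℝ))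
        (Ψ'.symm : E × ℝ →L[ℝ] E × ℝ) (Ξ.x, Ξ.t) := by
  obtain ⟨hPU, hφP⟩ := hright Ξ hΞ
  set P : Parabolic E := ⟨χ Ξ, Ξ.t⟩ with hP
  have hUo := isOpen_setOf_mk_mem hU
  have hPU' : ((χ Ξ, Ξ.t) : E × ℝ) ∈ {p : E × ℝ | (⟨p.1, p.2⟩ : Parabolic E) ∈ U} := hPU
  have hφat : ContDiffAt ℝ 2 (fun p : E × ℝ => φ ⟨p.1, p.2⟩) (χ Ξ, Ξ.t) :=
    hφ.contDiffAt (hUo.mem_nhds hPU')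
  obtain ⟨Ψ', hΨ'⟩ := exists_sliceEquiv (fderiv ℝ (fun p : E × ℝ => φ ⟨p.1, p.2⟩) (χ Ξ, Ξ.t))
    (A P) (coe_A_eq_fderiv_comp_inl hU hφ A hA hPU)
  refine ⟨Ψ', hΨ', ?_⟩
  set Ψ : E × ℝ → E × ℝ := fun p => (φ ⟨p.1, p.2⟩, p.2) with hΨdef
  have hΨat : ContDiffAt ℝ 2 Ψ (χ Ξ, Ξ.t) := hφat.prodMk contDiffAt_snd
  have hderiv : HasFDerivAt Ψ (Ψ' : E × ℝ →L[ℝ] E × ℝ) (χ Ξ, Ξ.t) := by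
    rw [hΨ']
    exact (hφat.differentiableAt (by norm_num)).hasFDerivAt.prodMk
      (hasFDerivAt_snd (𝕜 := ℝ) (E := E) (F := ℝ))
  have hstrict : HasStrictFDerivAt Ψ (Ψ' : E × ℝ →L[ℝ] E × ℝ) (χ Ξ, Ξ.t) :=
    hΨat.hasStrictFDerivAt' hderiv (by norm_num)
  have hg : ∀ᶠ p in 𝓝 ((χ Ξ, Ξ.t) : E × ℝ),
      (fun q : E × ℝ => ((χ ⟨q.1, q.2⟩, q.2) : E × ℝ)) (Ψ p) = p := by
    filter_upwards [hUo.mem_nhds hPU'] with p hp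
    simp only [hΨdef]
    exact Prod.ext (hleft _ hp) rfl
  have h := hstrict.to_local_left_inverse
    (g := fun q : E × ℝ => ((χ ⟨q.1, q.2⟩, q.2) : E × ℝ)) hg
  have hΨP : Ψ (χ Ξ, Ξ.t) = (Ξ.x, Ξ.t) := Prod.ext hφP rfl
  rwa [hΨP] at h

include hU hφ hleft hright hA in
/-- The joint derivative of the slice-wise inverse. [folklore] -/
theorem differentiableAt_sliceInverse {Ξ : Parabolic E} (hΞ : Ξ ∈ V) :
    DifferentiableAt ℝ (fun q : E × ℝ => χ ⟨q.1, q.2⟩) (Ξ.x, Ξ.t) := by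
  obtain ⟨Ψ', -, h⟩ := hasStrictFDerivAt_sliceInverse hU hφ hleft hright A hA hΞ
  exact h.hasFDerivAt.differentiableAt.fst

include hU hφ hleft hright hA in
/-- **`D χ = (D_x φ ∘ (χ, t))⁻¹`.** [folklore] -/
theorem spaceDeriv_sliceInverse {Ξ : Parabolic E} (hΞ : Ξ ∈ V) :
    spaceDeriv χ Ξ = ((A ⟨χ Ξ, Ξ.t⟩).symm : E →L[ℝ] E) := by
  obtain ⟨Ψ', hΨ', h⟩ := hasStrictFDerivAt_sliceInverse hU hφ hleft hright A hA hΞ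
  obtain ⟨hPU, -⟩ := hright Ξ hΞ
  have hpair := h.hasFDerivAt
  have hχ' : HasFDerivAt (fun q : E × ℝ => χ ⟨q.1, q.2⟩)
      ((ContinuousLinearMap.fst ℝ E ℝ).comp (Ψ'.symm : E × ℝ →L[ℝ] E × ℝ)) (Ξ.x, Ξ.t) :=
    hpair.fst
  cases Ξ with
  | mk ξ t =>
    rw [spaceDeriv_eq_fderiv_comp_inl hχ'.differentiableAt, hχ'.fderiv]
    ext k
    simp only [ContinuousLinearMap.coe_comp, Function.comp_apply, ContinuousLinearMap.inl_apply,
      ContinuousLinearMap.coe_fst']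
    -- `z = Ψ'⁻¹ (k, 0)` satisfies `Ψ' z = (k, 0)`
    set z := Ψ'.symm (k, 0) with hz
    have hzeq : Ψ' z = (k, 0) := Ψ'.apply_symm_apply (k, 0)
    have hz' : (Ψ' : E × ℝ →L[ℝ] E × ℝ) z = (k, 0) := hzeq
    rw [hΨ'] at hz'
    have h2 : z.2 = 0 := by
      have := congrArg Prod.snd hz'
      simpa using this
    have h1 : fderiv ℝ (fun p : E × ℝ => φ ⟨p.1, p.2⟩) (χ ⟨ξ, t⟩, t) z = k := by
      have := congrArg Prod.fst hz'
      simpa using this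
    have hzsplit : z = (z.1, 0) := by rw [← h2]
    rw [hzsplit] at h1
    have hAz : (A ⟨χ ⟨ξ, t⟩, t⟩ : E →L[ℝ] E) z.1 = k := by
      rw [coe_A_eq_fderiv_comp_inl hU hφ A hA hPU]
      simpa using h1
    show (Ψ'.symm (k, 0)).1 = (A ⟨χ ⟨ξ, t⟩, t⟩).symm k
    rw [← hz, ← hAz]
    exact ((A ⟨χ ⟨ξ, t⟩, t⟩).symm_apply_apply z.1).symm

include hU hφ hleft hright hA in
/-- **`∂ₜ χ = -(D_x φ)⁻¹ (∂ₜ φ) ∘ (χ, t)`.** [folklore] -/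
theorem timeDeriv_sliceInverse {Ξ : Parabolic E} (hΞ : Ξ ∈ V) :
    timeDeriv χ Ξ = -(A ⟨χ Ξ, Ξ.t⟩).symm (timeDeriv φ ⟨χ Ξ, Ξ.t⟩) := by
  obtain ⟨Ψ', hΨ', h⟩ := hasStrictFDerivAt_sliceInverse hU hφ hleft hright A hA hΞ
  obtain ⟨hPU, -⟩ := hright Ξ hΞ
  have hχ' : HasFDerivAt (fun q : E × ℝ => χ ⟨q.1, q.2⟩)
      ((ContinuousLinearMap.fst ℝ E ℝ).comp (Ψ'.symm : E × ℝ →L[ℝ] E × ℝ)) (Ξ.x, Ξ.t) :=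
    h.hasFDerivAt.fst
  have hφd : DifferentiableAt ℝ (fun p : E × ℝ => φ ⟨p.1, p.2⟩) (χ Ξ, Ξ.t) :=
    (hφ.contDiffAt ((isOpen_setOf_mk_mem hU).mem_nhds (by simpa using hPU))).differentiableAt
      (by norm_num)
  cases Ξ with
  | mk ξ t =>
    rw [← fderiv_apply_inr_eq_timeDeriv hχ'.differentiableAt, hχ'.fderiv]
    simp only [ContinuousLinearMap.coe_comp, Function.comp_apply, ContinuousLinearMap.coe_fst']
    set z := Ψ'.symm (0, 1) with hz
    have hzeq : (Ψ' : E × ℝ →L[ℝ] E × ℝ) z = (0, 1) := Ψ'.apply_symm_apply (0, 1)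
    rw [hΨ'] at hzeq
    have h2 : z.2 = 1 := by
      have := congrArg Prod.snd hzeq
      simpa using this
    have h1 : fderiv ℝ (fun p : E × ℝ => φ ⟨p.1, p.2⟩) (χ ⟨ξ, t⟩, t) z = 0 := by
      have := congrArg Prod.fst hzeq
      simpa using this
    have hzsplit : z = (z.1, 0) + (0, 1) := by
      ext <;> simp [h2]
    rw [hzsplit, map_add, fderiv_apply_inr_eq_timeDeriv hφd] at h1
    have hAz : (A ⟨χ ⟨ξ, t⟩, t⟩ : E →L[ℝ] E) z.1 = -timeDeriv φ ⟨χ ⟨ξ, t⟩, t⟩ := by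
      rw [coe_A_eq_fderiv_comp_inl hU hφ A hA hPU]
      have : fderiv ℝ (fun p : E × ℝ => φ ⟨p.1, p.2⟩) (χ ⟨ξ, t⟩, t) (z.1, 0) =
          -timeDeriv φ ⟨χ ⟨ξ, t⟩, t⟩ := eq_neg_of_add_eq_zero_left h1
      simpa using this
    show (Ψ'.symm (0, 1)).1 = -(A ⟨χ ⟨ξ, t⟩, t⟩).symm (timeDeriv φ ⟨χ ⟨ξ, t⟩, t⟩)
    rw [← hz, ← (A ⟨χ ⟨ξ, t⟩, t⟩).symm.map_neg, ← hAz]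
    exact ((A ⟨χ ⟨ξ, t⟩, t⟩).symm_apply_apply z.1).symm

include hU hφ hleft hright hA in
/-- The slice-wise inverse satisfies the regularity guard on an open `V`. [folklore] -/
theorem isC21On_sliceInverse (hV : IsOpen V) : IsC21On χ V := by
  have hUo := isOpen_setOf_mk_mem hU
  have hVo := isOpen_setOf_mk_mem hV
  have hleft' : ∀ p ∈ {p : E × ℝ | (⟨p.1, p.2⟩ : Parabolic E) ∈ U},
      (fun q : E × ℝ => χ ⟨q.1, q.2⟩) ((fun p : E × ℝ => φ ⟨p.1, p.2⟩) p, p.2) = p.1 :=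
    fun p hp => hleft _ hp
  have hright' : ∀ q ∈ {q : E × ℝ | (⟨q.1, q.2⟩ : Parabolic E) ∈ V},
      ((fun q : E × ℝ => χ ⟨q.1, q.2⟩) q, q.2) ∈ {p : E × ℝ | (⟨p.1, p.2⟩ : Parabolic E) ∈ U} ∧
      (fun p : E × ℝ => φ ⟨p.1, p.2⟩) ((fun q : E × ℝ => χ ⟨q.1, q.2⟩) q, q.2) = q.1 :=
    fun q hq => hright _ hq
  have hinv : ∀ p ∈ {p : E × ℝ | (⟨p.1, p.2⟩ : Parabolic E) ∈ U}, ∃ A' : E ≃L[ℝ] E,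
      (A' : E →L[ℝ] E) =
        (fderiv ℝ (fun p : E × ℝ => φ ⟨p.1, p.2⟩) p).comp (ContinuousLinearMap.inl ℝ E ℝ) :=
    fun p hp => ⟨A ⟨p.1, p.2⟩, coe_A_eq_fderiv_comp_inl hU hφ A hA hp⟩
  have hχ : ContDiffOn ℝ 2 (fun q : E × ℝ => χ ⟨q.1, q.2⟩)
      {q : E × ℝ | (⟨q.1, q.2⟩ : Parabolic E) ∈ V} := fun q hq =>
    (contDiffAt_sliceInverse (by norm_num) hUo hφ hleft' hright' hinv hq).contDiffWithinAt
  have h := isC21On_of_contDiffOn hVo le_rfl hχ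
  exact h.mono fun X hX => by simpa using hX

include hU hφ hleft hright hA in
/-- Spatial slices of `D χ`: derivative `v ↦ -(D_xφ)⁻¹ ∘ (D_x²φ (P) ((D_xφ)⁻¹ v)) ∘ (D_xφ)⁻¹`
(derivative of `Ring.inverse` at a unit, chain rule). [folklore] -/
theorem hasFDerivAt_spaceDeriv_sliceInverse (hV : IsOpen V) {ξ : E} {t : ℝ}
    (hΞ : (⟨ξ, t⟩ : Parabolic E) ∈ V) :
    HasFDerivAt (fun ξ' => spaceDeriv χ ⟨ξ', t⟩)
      (-(((ContinuousLinearMap.compL ℝ E E E).flip ((A ⟨χ ⟨ξ, t⟩, t⟩).symm : E →L[ℝ] E)).comp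
        (((ContinuousLinearMap.compL ℝ E E E) ((A ⟨χ ⟨ξ, t⟩, t⟩).symm : E →L[ℝ] E)).comp
          ((spaceDeriv (spaceDeriv φ) ⟨χ ⟨ξ, t⟩, t⟩).comp ((A ⟨χ ⟨ξ, t⟩, t⟩).symm : E →L[ℝ] E)))))
      ξ := by
  have hφC : IsC21On φ U := isC21On_of_setting hU hφ
  have hχC : IsC21On χ V := isC21On_sliceInverse hU hφ hleft hright A hA hV
  obtain ⟨hPU, -⟩ := hright _ hΞ
  -- near `ξ`, `Dχ (ξ', t) = Ring.inverse (Dφ (χ (ξ', t), t))`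
  have hslice : IsOpen {ξ' : E | (⟨ξ', t⟩ : Parabolic E) ∈ V} :=
    hV.preimage (homeomorphProd.symm.continuous.comp (continuous_id.prodMk continuous_const))
  have hev : (fun ξ' => spaceDeriv χ ⟨ξ', t⟩) =ᶠ[𝓝 ξ]
      fun ξ' => Ring.inverse (spaceDeriv φ ⟨χ ⟨ξ', t⟩, t⟩) := by
    filter_upwards [hslice.mem_nhds (show ξ ∈ {ξ' : E | (⟨ξ', t⟩ : Parabolic E) ∈ V} from hΞ)]
      with ξ' hξ'
    obtain ⟨hP'U, -⟩ := hright _ hξ'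
    rw [spaceDeriv_sliceInverse hU hφ hleft hright A hA hξ', ← hA _ hP'U]
    change _ = Ring.inverse ((A ⟨χ ⟨ξ', t⟩, t⟩).toUnit : E →L[ℝ] E)
    rw [Ring.inverse_unit]
    rfl
  refine HasFDerivAt.congr_of_eventuallyEq ?_ hev
  -- chain rule: `ξ' ↦ Dφ (χ (ξ', t), t)` has derivative `D²φ (P) ∘ Dχ`
  have h0 : HasFDerivAt (fun x' => spaceDeriv φ ⟨x', t⟩) (spaceDeriv (spaceDeriv φ) ⟨χ ⟨ξ, t⟩, t⟩)
      (χ ⟨ξ, t⟩) := hφC.hasFDerivAt_spaceDeriv hPU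
  have h1 := h0.comp ξ (hχC.hasFDerivAt_space hΞ)
  rw [spaceDeriv_sliceInverse hU hφ hleft hright A hA hΞ] at h1
  -- derivative of `Ring.inverse` at the unit `Dφ (P)`
  have h2 := hasFDerivAt_ringInverse (𝕜 := ℝ) ((A ⟨χ ⟨ξ, t⟩, t⟩).toUnit)
  have hunit : ((A ⟨χ ⟨ξ, t⟩, t⟩).toUnit : E →L[ℝ] E) = spaceDeriv φ ⟨χ ⟨ξ, t⟩, t⟩ := hA _ hPU
  rw [hunit] at h2
  have h3 := h2.comp ξ h1
  refine h3.congr_fderiv ?_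
  ext v w
  simp only [neg_apply, ContinuousLinearMap.coe_comp, Function.comp_apply,
    ContinuousLinearMap.mulLeftRight_apply, ContinuousLinearMap.compL_apply,
    ContinuousLinearMap.flip_apply, ContinuousLinearMap.mul_def]
  rfl

include hU hφ hleft hright hA in
/-- **`D² χ v w = -(D_xφ)⁻¹ (D_x²φ (P) (Dχ v) (Dχ w))`** on an open `V`. [folklore] -/
theorem spaceDeriv_spaceDeriv_sliceInverse (hV : IsOpen V) {Ξ : Parabolic E} (hΞ : Ξ ∈ V)
    (v w : E) :
    spaceDeriv (spaceDeriv χ) Ξ v w =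
      -(A ⟨χ Ξ, Ξ.t⟩).symm (spaceDeriv (spaceDeriv φ) ⟨χ Ξ, Ξ.t⟩
        ((A ⟨χ Ξ, Ξ.t⟩).symm v) ((A ⟨χ Ξ, Ξ.t⟩).symm w)) := by
  cases Ξ with
  | mk ξ t =>
    rw [show spaceDeriv (spaceDeriv χ) ⟨ξ, t⟩ = _ from
      (hasFDerivAt_spaceDeriv_sliceInverse hU hφ hleft hright A hA hV hΞ).fderiv]
    simp only [ContinuousLinearMap.coe_comp, Function.comp_apply, neg_apply,
      ContinuousLinearMap.compL_apply, ContinuousLinearMap.flip_apply]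
    rfl

/-! ### Bounds for the jets of the slice-wise inverse -/

omit [CompleteSpace E] in
/-- `A⁻¹ - A'⁻¹ = A⁻¹ (A' - A) A'⁻¹`, hence `‖A⁻¹ - A'⁻¹‖ ≤ ‖A⁻¹‖ ‖A'⁻¹‖ ‖A - A'‖`. [folklore] -/
theorem norm_symm_sub_symm_le (A₁ A₂ : E ≃L[ℝ] E) :
    ‖(A₁.symm : E →L[ℝ] E) - (A₂.symm : E →L[ℝ] E)‖ ≤
      ‖(A₁.symm : E →L[ℝ] E)‖ * ‖(A₂.symm : E →L[ℝ] E)‖ *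
        ‖(A₁ : E →L[ℝ] E) - (A₂ : E →L[ℝ] E)‖ := by
  have h : (A₁.symm : E →L[ℝ] E) - (A₂.symm : E →L[ℝ] E) =
      (A₁.symm : E →L[ℝ] E).comp (((A₂ : E →L[ℝ] E) - (A₁ : E →L[ℝ] E)).comp
        (A₂.symm : E →L[ℝ] E)) := by
    ext v
    simp only [sub_apply, ContinuousLinearMap.coe_comp, Function.comp_apply,
      map_sub, ContinuousLinearEquiv.coe_coe, ContinuousLinearEquiv.symm_apply_apply,
      ContinuousLinearEquiv.apply_symm_apply]
  rw [h]
  calc _ ≤ ‖(A₁.symm : E →L[ℝ] E)‖ * ‖(((A₂ : E →L[ℝ] E) - (A₁ : E →L[ℝ] E)).comp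
        (A₂.symm : E →L[ℝ] E))‖ := ContinuousLinearMap.opNorm_comp_le _ _
    _ ≤ ‖(A₁.symm : E →L[ℝ] E)‖ * (‖(A₂ : E →L[ℝ] E) - (A₁ : E →L[ℝ] E)‖ *
        ‖(A₂.symm : E →L[ℝ] E)‖) :=
        mul_le_mul_of_nonneg_left (ContinuousLinearMap.opNorm_comp_le _ _) (norm_nonneg _)
    _ = _ := by rw [norm_sub_rev]; ring

include hU hφ hleft hright hA in
/-- Sup bound `‖D χ‖ ≤ Λ₀`. [folklore] -/
theorem norm_spaceDeriv_sliceInverse_le {Λ₀ : ℝ}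
    (hΛ₀ : ∀ X ∈ U, ‖((A X).symm : E →L[ℝ] E)‖ ≤ Λ₀) {Ξ : Parabolic E} (hΞ : Ξ ∈ V) :
    ‖spaceDeriv χ Ξ‖ ≤ Λ₀ := by
  rw [spaceDeriv_sliceInverse hU hφ hleft hright A hA hΞ]
  exact hΛ₀ _ (hright Ξ hΞ).1

include hU hφ hleft hright hA in
/-- Sup bound `‖∂ₜ χ‖ ≤ Λ₀ Bₜ`. [folklore] -/
theorem norm_timeDeriv_sliceInverse_le {Λ₀ Bₜ : ℝ}
    (hΛ₀ : ∀ X ∈ U, ‖((A X).symm : E →L[ℝ] E)‖ ≤ Λ₀) (hBₜ : ∀ X ∈ U, ‖timeDeriv φ X‖ ≤ Bₜ)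
    {Ξ : Parabolic E} (hΞ : Ξ ∈ V) : ‖timeDeriv χ Ξ‖ ≤ Λ₀ * Bₜ := by
  have hPU := (hright Ξ hΞ).1
  have hΛ0 : 0 ≤ Λ₀ := (norm_nonneg _).trans (hΛ₀ _ hPU)
  rw [timeDeriv_sliceInverse hU hφ hleft hright A hA hΞ, norm_neg]
  calc ‖(A ⟨χ Ξ, Ξ.t⟩).symm (timeDeriv φ ⟨χ Ξ, Ξ.t⟩)‖
      = ‖((A ⟨χ Ξ, Ξ.t⟩).symm : E →L[ℝ] E) (timeDeriv φ ⟨χ Ξ, Ξ.t⟩)‖ := rfl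
    _ ≤ ‖((A ⟨χ Ξ, Ξ.t⟩).symm : E →L[ℝ] E)‖ * ‖timeDeriv φ ⟨χ Ξ, Ξ.t⟩‖ :=
        ContinuousLinearMap.le_opNorm _ _
    _ ≤ Λ₀ * Bₜ := mul_le_mul (hΛ₀ _ hPU) (hBₜ _ hPU) (norm_nonneg _) hΛ0

include hU hφ hleft hright hA in
/-- Sup bound `‖D² χ‖ ≤ Λ₀³ B₂` on an open `V`. [folklore] -/
theorem norm_spaceDeriv_spaceDeriv_sliceInverse_le (hV : IsOpen V) {Λ₀ B₂ : ℝ} (hΛ0 : 0 ≤ Λ₀)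
    (hΛ₀ : ∀ X ∈ U, ‖((A X).symm : E →L[ℝ] E)‖ ≤ Λ₀)
    (hB₂ : ∀ X ∈ U, ‖spaceDeriv (spaceDeriv φ) X‖ ≤ B₂) {Ξ : Parabolic E} (hΞ : Ξ ∈ V) :
    ‖spaceDeriv (spaceDeriv χ) Ξ‖ ≤ Λ₀ ^ 3 * B₂ := by
  have hPU := (hright Ξ hΞ).1
  have hB0 : 0 ≤ B₂ := (norm_nonneg _).trans (hB₂ _ hPU)
  set S : E →L[ℝ] E := ((A ⟨χ Ξ, Ξ.t⟩).symm : E →L[ℝ] E) with hS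
  have hSb : ‖S‖ ≤ Λ₀ := hΛ₀ _ hPU
  refine ContinuousLinearMap.opNorm_le_bound _ (by positivity) fun v => ?_
  refine ContinuousLinearMap.opNorm_le_bound _ (by positivity) fun w => ?_
  rw [spaceDeriv_spaceDeriv_sliceInverse hU hφ hleft hright A hA hV hΞ, norm_neg]
  calc ‖(A ⟨χ Ξ, Ξ.t⟩).symm (spaceDeriv (spaceDeriv φ) ⟨χ Ξ, Ξ.t⟩ ((A ⟨χ Ξ, Ξ.t⟩).symm v)
        ((A ⟨χ Ξ, Ξ.t⟩).symm w))‖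
      = ‖S (spaceDeriv (spaceDeriv φ) ⟨χ Ξ, Ξ.t⟩ (S v) (S w))‖ := rfl
    _ ≤ ‖S‖ * ‖spaceDeriv (spaceDeriv φ) ⟨χ Ξ, Ξ.t⟩ (S v) (S w)‖ := S.le_opNorm _
    _ ≤ Λ₀ * (B₂ * (Λ₀ * ‖v‖) * (Λ₀ * ‖w‖)) := by
        refine mul_le_mul hSb ?_ (norm_nonneg _) hΛ0
        calc _ ≤ ‖spaceDeriv (spaceDeriv φ) ⟨χ Ξ, Ξ.t⟩‖ * ‖S v‖ * ‖S w‖ :=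
              ContinuousLinearMap.le_opNorm₂ _ _ _
          _ ≤ B₂ * (Λ₀ * ‖v‖) * (Λ₀ * ‖w‖) := by
              gcongr
              · exact hB₂ _ hPU
              · exact (S.le_opNorm v).trans (mul_le_mul_of_nonneg_right hSb (norm_nonneg _))
              · exact (S.le_opNorm w).trans (mul_le_mul_of_nonneg_right hSb (norm_nonneg _))
    _ = Λ₀ ^ 3 * B₂ * ‖v‖ * ‖w‖ := by ring

include hU hφ hleft hright hA in
/-- Hölder modulus of `D χ`: `‖Dχ Ξ - Dχ Ξ'‖ ≤ Λ₀² K₁ Λ^α d(Ξ, Ξ')^α`, where `Λ` is the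
parabolic Lipschitz constant of `Ξ ↦ (χ Ξ, t)` and `K₁` the modulus of `D φ`. [folklore] -/
theorem norm_spaceDeriv_sliceInverse_sub_le {α : ℝ≥0} {Λ₀ K₁ Λ : ℝ} (hΛ0 : 0 ≤ Λ₀)
    (hK0 : 0 ≤ K₁) (hΛ : 0 ≤ Λ)
    (hΛ₀ : ∀ X ∈ U, ‖((A X).symm : E →L[ℝ] E)‖ ≤ Λ₀)
    (hK₁ : ∀ X ∈ U, ∀ X' ∈ U, ‖spaceDeriv φ X - spaceDeriv φ X'‖ ≤ K₁ * dist X X' ^ (α : ℝ))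
    (hLip : ∀ Ξ ∈ V, ∀ Ξ' ∈ V,
      dist (⟨χ Ξ, Ξ.t⟩ : Parabolic E) ⟨χ Ξ', Ξ'.t⟩ ≤ Λ * dist Ξ Ξ')
    {Ξ Ξ' : Parabolic E} (hΞ : Ξ ∈ V) (hΞ' : Ξ' ∈ V) :
    ‖spaceDeriv χ Ξ - spaceDeriv χ Ξ'‖ ≤ Λ₀ ^ 2 * K₁ * Λ ^ (α : ℝ) * dist Ξ Ξ' ^ (α : ℝ) := by
  have hPU := (hright Ξ hΞ).1
  have hP'U := (hright Ξ' hΞ').1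
  rw [spaceDeriv_sliceInverse hU hφ hleft hright A hA hΞ,
    spaceDeriv_sliceInverse hU hφ hleft hright A hA hΞ']
  refine (norm_symm_sub_symm_le _ _).trans ?_
  rw [hA _ hPU, hA _ hP'U]
  have h1 : ‖spaceDeriv φ ⟨χ Ξ, Ξ.t⟩ - spaceDeriv φ ⟨χ Ξ', Ξ'.t⟩‖ ≤
      K₁ * Λ ^ (α : ℝ) * dist Ξ Ξ' ^ (α : ℝ) :=
    calc _ ≤ K₁ * dist (⟨χ Ξ, Ξ.t⟩ : Parabolic E) ⟨χ Ξ', Ξ'.t⟩ ^ (α : ℝ) := hK₁ _ hPU _ hP'U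
      _ ≤ K₁ * (Λ ^ (α : ℝ) * dist Ξ Ξ' ^ (α : ℝ)) :=
          mul_le_mul_of_nonneg_left (rpow_dist_scomp_le hΛ (hLip Ξ hΞ Ξ' hΞ')) hK0
      _ = _ := by ring
  calc _ ≤ Λ₀ * Λ₀ * (K₁ * Λ ^ (α : ℝ) * dist Ξ Ξ' ^ (α : ℝ)) := by
        refine mul_le_mul (mul_le_mul (hΛ₀ _ hPU) (hΛ₀ _ hP'U) (norm_nonneg _) hΛ0) h1
          (norm_nonneg _) (by positivity)
    _ = _ := by ring

include hU hφ hleft hright hA in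
/-- Hölder modulus of `∂ₜ χ`: constant `Λ₀² K₁ Λ^α Bₜ + Λ₀ Kₜ Λ^α`. [folklore] -/
theorem norm_timeDeriv_sliceInverse_sub_le {α : ℝ≥0} {Λ₀ K₁ Kₜ Bₜ Λ : ℝ} (hΛ0 : 0 ≤ Λ₀)
    (hK0 : 0 ≤ K₁) (hKt0 : 0 ≤ Kₜ) (hΛ : 0 ≤ Λ)
    (hΛ₀ : ∀ X ∈ U, ‖((A X).symm : E →L[ℝ] E)‖ ≤ Λ₀)
    (hBₜ : ∀ X ∈ U, ‖timeDeriv φ X‖ ≤ Bₜ)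
    (hK₁ : ∀ X ∈ U, ∀ X' ∈ U, ‖spaceDeriv φ X - spaceDeriv φ X'‖ ≤ K₁ * dist X X' ^ (α : ℝ))
    (hKₜ : ∀ X ∈ U, ∀ X' ∈ U, ‖timeDeriv φ X - timeDeriv φ X'‖ ≤ Kₜ * dist X X' ^ (α : ℝ))
    (hLip : ∀ Ξ ∈ V, ∀ Ξ' ∈ V,
      dist (⟨χ Ξ, Ξ.t⟩ : Parabolic E) ⟨χ Ξ', Ξ'.t⟩ ≤ Λ * dist Ξ Ξ')
    {Ξ Ξ' : Parabolic E} (hΞ : Ξ ∈ V) (hΞ' : Ξ' ∈ V) :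
    ‖timeDeriv χ Ξ - timeDeriv χ Ξ'‖ ≤
      (Λ₀ ^ 2 * K₁ * Λ ^ (α : ℝ) * Bₜ + Λ₀ * Kₜ * Λ ^ (α : ℝ)) * dist Ξ Ξ' ^ (α : ℝ) := by
  have hPU := (hright Ξ hΞ).1
  have hP'U := (hright Ξ' hΞ').1
  have hD := norm_spaceDeriv_sliceInverse_sub_le hU hφ hleft hright A hA hΛ0 hK0 hΛ hΛ₀ hK₁ hLip
    hΞ hΞ'
  rw [spaceDeriv_sliceInverse hU hφ hleft hright A hA hΞ,
    spaceDeriv_sliceInverse hU hφ hleft hright A hA hΞ'] at hD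
  rw [timeDeriv_sliceInverse hU hφ hleft hright A hA hΞ,
    timeDeriv_sliceInverse hU hφ hleft hright A hA hΞ', neg_sub_neg]
  have h2 : ‖timeDeriv φ ⟨χ Ξ', Ξ'.t⟩ - timeDeriv φ ⟨χ Ξ, Ξ.t⟩‖ ≤
      Kₜ * Λ ^ (α : ℝ) * dist Ξ Ξ' ^ (α : ℝ) :=
    calc _ ≤ Kₜ * dist (⟨χ Ξ', Ξ'.t⟩ : Parabolic E) ⟨χ Ξ, Ξ.t⟩ ^ (α : ℝ) := hKₜ _ hP'U _ hPU
      _ ≤ Kₜ * (Λ ^ (α : ℝ) * dist Ξ Ξ' ^ (α : ℝ)) := by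
          refine mul_le_mul_of_nonneg_left ?_ hKt0
          rw [dist_comm Ξ Ξ']
          have h := hLip Ξ' hΞ' Ξ hΞ
          exact rpow_dist_scomp_le hΛ h
      _ = _ := by ring
  have hBt0 : 0 ≤ Bₜ := (norm_nonneg _).trans (hBₜ _ hPU)
  calc ‖((A ⟨χ Ξ', Ξ'.t⟩).symm : E →L[ℝ] E) (timeDeriv φ ⟨χ Ξ', Ξ'.t⟩) -
        ((A ⟨χ Ξ, Ξ.t⟩).symm : E →L[ℝ] E) (timeDeriv φ ⟨χ Ξ, Ξ.t⟩)‖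
      ≤ ‖((A ⟨χ Ξ', Ξ'.t⟩).symm : E →L[ℝ] E) - ((A ⟨χ Ξ, Ξ.t⟩).symm : E →L[ℝ] E)‖ *
          ‖timeDeriv φ ⟨χ Ξ', Ξ'.t⟩‖ +
        ‖((A ⟨χ Ξ, Ξ.t⟩).symm : E →L[ℝ] E)‖ *
          ‖timeDeriv φ ⟨χ Ξ', Ξ'.t⟩ - timeDeriv φ ⟨χ Ξ, Ξ.t⟩‖ := norm_apply_sub_apply_le _ _ _ _
    _ ≤ Λ₀ ^ 2 * K₁ * Λ ^ (α : ℝ) * dist Ξ Ξ' ^ (α : ℝ) * Bₜ +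
        Λ₀ * (Kₜ * Λ ^ (α : ℝ) * dist Ξ Ξ' ^ (α : ℝ)) := by
        refine add_le_add (mul_le_mul ?_ (hBₜ _ hP'U) (norm_nonneg _) (by positivity))
          (mul_le_mul (hΛ₀ _ hPU) h2 (norm_nonneg _) hΛ0)
        rwa [norm_sub_rev]
    _ = _ := by ring

include hU hφ hleft hright hA in
/-- Hölder modulus of `D² χ` on an open `V`: constant
`Λ₀² K₁ Λ^α (Λ₀² B₂) + Λ₀ (K₂ Λ^α Λ₀² + 2 B₂ Λ₀ (Λ₀² K₁ Λ^α))`. [folklore] -/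
theorem norm_spaceDeriv_spaceDeriv_sliceInverse_sub_le (hV : IsOpen V) {α : ℝ≥0}
    {Λ₀ K₁ K₂ B₂ Λ : ℝ} (hΛ0 : 0 ≤ Λ₀) (hK0 : 0 ≤ K₁) (hK20 : 0 ≤ K₂) (hB0 : 0 ≤ B₂) (hΛ : 0 ≤ Λ)
    (hΛ₀ : ∀ X ∈ U, ‖((A X).symm : E →L[ℝ] E)‖ ≤ Λ₀)
    (hB₂ : ∀ X ∈ U, ‖spaceDeriv (spaceDeriv φ) X‖ ≤ B₂)
    (hK₁ : ∀ X ∈ U, ∀ X' ∈ U, ‖spaceDeriv φ X - spaceDeriv φ X'‖ ≤ K₁ * dist X X' ^ (α : ℝ))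
    (hK₂ : ∀ X ∈ U, ∀ X' ∈ U, ‖spaceDeriv (spaceDeriv φ) X - spaceDeriv (spaceDeriv φ) X'‖ ≤
      K₂ * dist X X' ^ (α : ℝ))
    (hLip : ∀ Ξ ∈ V, ∀ Ξ' ∈ V,
      dist (⟨χ Ξ, Ξ.t⟩ : Parabolic E) ⟨χ Ξ', Ξ'.t⟩ ≤ Λ * dist Ξ Ξ')
    {Ξ Ξ' : Parabolic E} (hΞ : Ξ ∈ V) (hΞ' : Ξ' ∈ V) :
    ‖spaceDeriv (spaceDeriv χ) Ξ - spaceDeriv (spaceDeriv χ) Ξ'‖ ≤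
      (Λ₀ ^ 2 * K₁ * Λ ^ (α : ℝ) * (Λ₀ ^ 2 * B₂) +
        Λ₀ * (K₂ * Λ ^ (α : ℝ) * Λ₀ ^ 2 + B₂ * (Λ₀ ^ 2 * K₁ * Λ ^ (α : ℝ)) * (Λ₀ + Λ₀))) *
        dist Ξ Ξ' ^ (α : ℝ) := by
  have hPU := (hright Ξ hΞ).1
  have hP'U := (hright Ξ' hΞ').1
  have hd : 0 ≤ dist Ξ Ξ' ^ (α : ℝ) := by positivity
  set dα := dist Ξ Ξ' ^ (α : ℝ) with hdα
  -- the inverse differentials and the second derivatives at the two points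
  set S : E →L[ℝ] E := ((A ⟨χ Ξ, Ξ.t⟩).symm : E →L[ℝ] E) with hS
  set S' : E →L[ℝ] E := ((A ⟨χ Ξ', Ξ'.t⟩).symm : E →L[ℝ] E) with hS'
  set M := spaceDeriv (spaceDeriv φ) ⟨χ Ξ, Ξ.t⟩ with hM
  set M' := spaceDeriv (spaceDeriv φ) ⟨χ Ξ', Ξ'.t⟩ with hM'
  have hSS' : ‖S - S'‖ ≤ Λ₀ ^ 2 * K₁ * Λ ^ (α : ℝ) * dα := by
    have h := norm_spaceDeriv_sliceInverse_sub_le hU hφ hleft hright A hA hΛ0 hK0 hΛ hΛ₀ hK₁ hLip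
      hΞ hΞ'
    rwa [spaceDeriv_sliceInverse hU hφ hleft hright A hA hΞ,
      spaceDeriv_sliceInverse hU hφ hleft hright A hA hΞ'] at h
  have hMM' : ‖M - M'‖ ≤ K₂ * Λ ^ (α : ℝ) * dα :=
    calc _ ≤ K₂ * dist (⟨χ Ξ, Ξ.t⟩ : Parabolic E) ⟨χ Ξ', Ξ'.t⟩ ^ (α : ℝ) := hK₂ _ hPU _ hP'U
      _ ≤ K₂ * (Λ ^ (α : ℝ) * dα) :=
          mul_le_mul_of_nonneg_left (rpow_dist_scomp_le hΛ (hLip Ξ hΞ Ξ' hΞ')) hK20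
      _ = _ := by ring
  have hSb : ‖S‖ ≤ Λ₀ := hΛ₀ _ hPU
  have hS'b : ‖S'‖ ≤ Λ₀ := hΛ₀ _ hP'U
  have hM'b : ‖M'‖ ≤ B₂ := hB₂ _ hP'U
  have hMb : ‖M‖ ≤ B₂ := hB₂ _ hPU
  have hpos : 0 ≤ Λ₀ ^ 2 * K₁ * Λ ^ (α : ℝ) * (Λ₀ ^ 2 * B₂) +
      Λ₀ * (K₂ * Λ ^ (α : ℝ) * Λ₀ ^ 2 + B₂ * (Λ₀ ^ 2 * K₁ * Λ ^ (α : ℝ)) * (Λ₀ + Λ₀)) := by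
    positivity
  refine ContinuousLinearMap.opNorm_le_bound _ (mul_nonneg hpos hd) fun v => ?_
  refine ContinuousLinearMap.opNorm_le_bound _ (by positivity) fun w => ?_
  rw [sub_apply, sub_apply, spaceDeriv_spaceDeriv_sliceInverse hU hφ hleft hright A hA hV hΞ,
    spaceDeriv_spaceDeriv_sliceInverse hU hφ hleft hright A hA hV hΞ', neg_sub_neg]
  change ‖S' (M' (S' v) (S' w)) - S (M (S v) (S w))‖ ≤ _
  -- `‖S' N' - S N‖ ≤ ‖S' - S‖ ‖N'‖ + ‖S‖ ‖N' - N‖`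
  have hN'b : ‖M' (S' v) (S' w)‖ ≤ B₂ * Λ₀ ^ 2 * ‖v‖ * ‖w‖ :=
    calc _ ≤ ‖M'‖ * ‖S' v‖ * ‖S' w‖ := M'.le_opNorm₂ _ _
      _ ≤ B₂ * (Λ₀ * ‖v‖) * (Λ₀ * ‖w‖) := by
          gcongr
          · exact (S'.le_opNorm v).trans (mul_le_mul_of_nonneg_right hS'b (norm_nonneg _))
          · exact (S'.le_opNorm w).trans (mul_le_mul_of_nonneg_right hS'b (norm_nonneg _))
      _ = _ := by ring
  have hNN' : ‖M' (S' v) (S' w) - M (S v) (S w)‖ ≤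
      (K₂ * Λ ^ (α : ℝ) * dα * Λ₀ ^ 2 + B₂ * (Λ₀ ^ 2 * K₁ * Λ ^ (α : ℝ) * dα) * (Λ₀ + Λ₀)) *
        ‖v‖ * ‖w‖ := by
    refine (norm_bilin_comp_sub_le M' M S' S v w).trans ?_
    have e1 : ‖M' - M‖ * ‖S'‖ ^ 2 ≤ K₂ * Λ ^ (α : ℝ) * dα * Λ₀ ^ 2 := by
      rw [norm_sub_rev]
      exact mul_le_mul hMM' (pow_le_pow_left₀ (norm_nonneg _) hS'b 2) (by positivity)
        (by positivity)
    have e2 : ‖M‖ * ‖S' - S‖ * (‖S'‖ + ‖S‖) ≤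
        B₂ * (Λ₀ ^ 2 * K₁ * Λ ^ (α : ℝ) * dα) * (Λ₀ + Λ₀) := by
      rw [norm_sub_rev]
      exact mul_le_mul (mul_le_mul hMb hSS' (norm_nonneg _) hB0) (add_le_add hS'b hSb)
        (by positivity) (by positivity)
    have hvw : 0 ≤ ‖v‖ * ‖w‖ := by positivity
    calc (‖M' - M‖ * ‖S'‖ ^ 2 + ‖M‖ * ‖S' - S‖ * (‖S'‖ + ‖S‖)) * ‖v‖ * ‖w‖
        = (‖M' - M‖ * ‖S'‖ ^ 2 + ‖M‖ * ‖S' - S‖ * (‖S'‖ + ‖S‖)) * (‖v‖ * ‖w‖) := by ring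
      _ ≤ (K₂ * Λ ^ (α : ℝ) * dα * Λ₀ ^ 2 + B₂ * (Λ₀ ^ 2 * K₁ * Λ ^ (α : ℝ) * dα) * (Λ₀ + Λ₀)) *
          (‖v‖ * ‖w‖) := mul_le_mul_of_nonneg_right (add_le_add e1 e2) hvw
      _ = _ := by ring
  calc ‖S' (M' (S' v) (S' w)) - S (M (S v) (S w))‖
      ≤ ‖S' - S‖ * ‖M' (S' v) (S' w)‖ + ‖S‖ * ‖M' (S' v) (S' w) - M (S v) (S w)‖ :=
        norm_apply_sub_apply_le _ _ _ _
    _ ≤ Λ₀ ^ 2 * K₁ * Λ ^ (α : ℝ) * dα * (B₂ * Λ₀ ^ 2 * ‖v‖ * ‖w‖) +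
        Λ₀ * ((K₂ * Λ ^ (α : ℝ) * dα * Λ₀ ^ 2 +
          B₂ * (Λ₀ ^ 2 * K₁ * Λ ^ (α : ℝ) * dα) * (Λ₀ + Λ₀)) * ‖v‖ * ‖w‖) := by
        refine add_le_add (mul_le_mul ?_ hN'b (norm_nonneg _) (by positivity))
          (mul_le_mul hSb hNN' (norm_nonneg _) hΛ0)
        rwa [norm_sub_rev]
    _ = _ := by ring

end Setting

end ParabolicFlow

end Literature.Geometry.Riemannian
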